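import Mathlib
import Literature.NumberTheory.EllipticCurves.IwasawaAlgebra
import Summits.BirchSwinnertonDyer.BirchSwinnertonDyer.Theorems.ErratumRoadFiveCharIdealTransferTorsion
import Summits.BirchSwinnertonDyer.BirchSwinnertonDyer.Theorems.AlignedTransportAtTwoMainConjectureOfRankZeroBSDAtTwoFineRoadKleinCountingCyclicDescent

/-!
# QTAME door 5 — (G0-bc): the characteristic ideal under FLAT base change (pure algebra) — v1.4 (g22)

Crux workfile for `stmt-BirchSwinnertonDyer-20728` (`TwoVariableEulerSystemDivisibility`), idea
`qtame`, seat `bsd-idea-14` (g22). An IDEA WORKFILE, not a skeleton: no `stub_*`, no `sorry`; the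
skeleton of record stays `Lines/ratlift.lean` v4. HONEST FRAMING: no summit statement, no crux and
no stub is proved here; this is commutative algebra only.

## What and why

Door 5 (`QtameDoor5O.lean`, `door5_wittVector`) runs over the coefficient ring `𝒪 = W(𝔽̄_p)` where
the Greenberg / Katz `L`-function `G` has its coefficients, for the module
`X′ := Λ′ ⊗_{Λ₂} X_Gr₂`, `Λ′ = W(𝔽̄_p)⟦T₁⟧⟦T₂⟧`, and concludes `(p^a G) ⊆ ch_{Λ′}(X′)`. The crux /
F1 is stated with `(ch_{Λ₂} X_Gr₂)·(coefficient extension)`. The seam between the two is the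
dossier's item **(G0-bc)**: `ch_{Λ′}(Λ′ ⊗_{Λ₂} X) ⊆ ch_{Λ₂}(X)·Λ′`. This file proves it for ANY flat
extension of Noetherian unique factorisation domains:

* `charIdeal_baseChange_eq` / `charIdeal_baseChange_le` : for `A → B` injective and FLAT, `A`, `B`
  Noetherian UFDs, and `N` a finitely generated `A`-module killed by some `c ≠ 0`,
  `charIdeal B (B ⊗[A] N) = (charIdeal A N).map (algebraMap A B)` (and the `≤` F1 consumes);
* `span_le_map_charIdeal_of_engine`, `f1_shape_of_engine` : the door-5 composition
  `(p^a G₀) ⊆ ch_B(B ⊗ X) ⟹ (p^a φG₀) ⊆ ch_A(X)·C` along `A → B → C` (the F1 / crux shape);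
* (v1.1, §3) `lengthAt_baseChange_eq_of_prime` : for `A → B` flat and `π` prime in `A` with PRIME image
  `π'` in `B` (the case `p ∈ Λ₂ → Λ′`: `Λ′/p = 𝔽̄_p⟦T₁⟧⟦T₂⟧`), `ℓ_{(π')}(B ⊗_A N) = ℓ_{(π)}(N)`; with
  `QtameDoor5O.door5_explicit` (exponent `a = ℓ_{(p)}(X′)`) this makes the slack of door 5 EQUAL to the
  `μ`-multiplicity `ℓ_{(p)}(X_Gr₂)`, so `μ_{(p)}(X_Gr₂) = 0 ⟹ (G) ⊆ ch(X_Gr₂)·Λ′` with NO `p`-power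
  (crux 20728 as typed; `lengthAt_baseChange_eq_zero_of_prime` + `QtameDoor5O.door5_mu_zero`);
* (v1.2, §4) `lengthAt_eq_zero_of_lengthAt_quotient_smul_top_eq_zero` : `ℓ_Q(N ⧸ xN) = 0`, `x ∈ Q ⊇ P`
  ⟹ `ℓ_P(N) = 0` (nilpotent Nakayama, tree `CyclicDescent.lengthAt_eq_zero_iff_lengthAt_quotient_range_eq_zero`,
  + generisation) and the composite `lengthAt_baseChange_eq_zero_of_quotient_line`: so `μ_{(p)}(X_Gr₂) = 0`
  ⟸ `ℓ_{(p,T₁)}(X_Gr₂ ⧸ T₁) = 0` ⟸ ratlift v4's MU0 + TS1 along exact control `X_Gr₂ ⧸ T₁ ≅ X_ac` —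
  NOTHING new is owed for the as-typed form (ratlift v4's registered composition already turns F1 + MU0
  + TS1 into 20728; §§3–4 only make the `μ`-bookkeeping of that step explicit for the door-5 exponent);
* (v1.2, §5) `dvd_of_span_le_map_charIdeal` / `toNat_lengthAt_eq_zero_of_span_le_map_charIdeal` :
  NECESSITY — `span{G} ≤ ch_A(N)·C` with `μ_{(π)}(N) ≥ 1` forces `φ π ∣ G`; the crux's antecedent
  (BCS 2025 Prop. 4.2.2: unit content of `minus G`) excludes `p ∣ G`, so 20728 as typed itself implies
  `μ_{(p)}(X_Gr₂) = 0`;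
* (v1.3, §6) (bc-5) of critic V#26q in the ZERO currency: `lengthAt_eq_zero_of_lengthAt_comap_eq_zero`
  (`ℓ^S_{f⁻¹Q}(N) = 0 ⟹ ℓ^A_Q(N) = 0` when `S` acts through `f : S → A`; no length identity needed) and
  `lengthAt_eq_zero_of_mem_charIdeal_of_not_dvd` (MU0's currency `g ∈ ch(N)`, `π ∤ g`, torsion ⟹
  `ℓ_{(π)}(N) = 0`), so the chain MU0 + TS1 ⟹ ℓ^{Λ₁}_{(p)}(X_ac) = 0 ⟹ (exact control, `Λ₁`-linear)
  ℓ^{Λ₁}_{(p)}(X_Gr₂/T₁) = 0 ⟹ (§6(i), `f⁻¹(p,T₁) = (p)`) ℓ^{Λ₂}_{(p,T₁)}(X_Gr₂/T₁) = 0 ⟹ §4 ⟹ §3 ⟹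
  `door5_mu_zero` is typed except for the two frame-level identities named in §6.
* (v1.4, §7) (bc-5′) of critic V#26r generically: `comap_C_span_C_X_eq : (span {C c, X}).comap C = span {c}` in `R⟦X⟧`
  (`comap_C_span_natCast_X_eq` for `c = p`), and (bc-5″) `compHom_smul_eq` (`rfl`); (bc-5) is thereby instantiation only.

Proof: Noetherian induction on `N` (`IsNoetherianRing.induction_on_isQuotientEquivQuotientPrime`):
both sides are multiplicative in short exact sequences (`Module.charIdeal_eq_mul_of_exact` on each
side; flatness keeps `B ⊗ –` exact), and for `N = A/𝔮`: if `ht 𝔮 = 1` then `𝔮 = (π)`,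
`B ⊗ N = B/(π)` and both sides equal `(π)B` (`charIdeal_quotient_span_singleton`: in a Noetherian
UFD `ch(R/(x)) = (x)` for `x ≠ 0`); if `ht 𝔮 ≥ 2` both sides are `B` (right: no height-one prime
contains `𝔮`; left: going-down for the flat map — a height-one prime of `B` above `𝔮B` would
contract to a prime of height `≤ 1` containing `𝔮`).

What (G0-bc) still needs beyond this file (dossier `Door5.md` §4 item 0): (bc-1) flatness of
`ℤ_p⟦T₁⟧⟦T₂⟧ → W(𝔽̄_p)⟦T₁⟧⟦T₂⟧` («miracle flatness» for the regular local rings of dimension 3,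
Matsumura CRT 23.1 — not in Mathlib / the tree; for a FINITE free coefficient ring it is door 3's
`flatS`), and (bc-4) the factorisation of `toUnr₂` through `Λ′` (frame typing).

References: Bourbaki AC VII §4.5 Prop. 10 (multiplicativity), §4.7 (divisorial ideals in Krull
domains); [NeukirchSchmidtWingberg2008] (5.3.9) Remark 2; Matsumura CRT Thm 23.1.
-/

set_option linter.dupNamespace false

noncomputable section

open scoped TensorProduct Classical
open Literature.NumberTheory.EllipticCurves Literature.NumberTheory.EllipticCurves.Module

namespace Summit.BirchSwinnertonDyer.BirchSwinnertonDyer.Cruxes.TwoVariableEulerSystemDivisibility.QtameBaseChange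

universe u v w

/-! ## §1 Generic lemmas: characteristic ideal of a cyclic module, invariance, triviality -/

section Generic

variable {R : Type u} [CommRing R]

/-- `char` is invariant under linear equivalence. -/
theorem charIdeal_eq_of_linearEquiv {M : Type v} {M' : Type w} [AddCommGroup M] [Module R M]
    [AddCommGroup M'] [Module R M'] (e : M ≃ₗ[R] M') : charIdeal R M = charIdeal R M' := by
  unfold charIdeal
  exact finprod_mem_congr rfl fun 𝔭 _ => by rw [lengthAt_eq_of_linearEquiv e 𝔭]

/-- `char` of a module all of whose height-one local lengths vanish is `⊤`. -/
theorem charIdeal_eq_top_of_forall {M : Type v} [AddCommGroup M] [Module R M]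
    (h : ∀ 𝔭 : PrimeSpectrum R, 𝔭.asIdeal.height = 1 → lengthAt R M 𝔭 = 0) :
    charIdeal R M = ⊤ := by
  unfold charIdeal
  rw [← Ideal.one_eq_top]
  rw [finprod_mem_congr (s := {𝔭 : PrimeSpectrum R | 𝔭.asIdeal.height = 1}) rfl
    (g := fun _ => (1 : Ideal R)) fun 𝔭 h𝔭 => by rw [h 𝔭 h𝔭]; simp]
  exact finprod_mem_one _

/-- `char` of a module with no elements is `⊤`. -/
theorem charIdeal_eq_top_of_subsingleton {M : Type v} [AddCommGroup M] [Module R M]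
    [Subsingleton M] : charIdeal R M = ⊤ :=
  charIdeal_eq_top_of_forall fun 𝔭 _ => lengthAt_eq_zero_of_subsingleton 𝔭

variable [IsNoetherianRing R] [IsDomain R]

/-- `char(R/𝔮) = ⊤` for a prime `𝔮 ≠ 0` of height `≠ 1` (no height-one prime contains it). -/
theorem charIdeal_quotient_eq_top_of_height_ne_one (𝔮 : PrimeSpectrum R) (h0 : 𝔮.asIdeal ≠ ⊥)
    (h1 : 𝔮.asIdeal.height ≠ 1) : charIdeal R (R ⧸ 𝔮.asIdeal) = ⊤ := by
  refine charIdeal_eq_top_of_forall fun 𝔭 h𝔭 => lengthAt_quotient_eq_zero_of_not_le fun hle => ?_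
  have hge : 𝔭.asIdeal.height ≤ 𝔮.asIdeal.height := by
    rw [h𝔭, Order.one_le_iff_ne_zero, Ne, Ideal.height_eq_zero_iff_eq_bot]
    exact h0
  have := Ideal.eq_of_le_of_height_le (I := 𝔮.asIdeal) (J := 𝔭.asIdeal) hle hge
  exact h1 (this ▸ h𝔭)

variable [UniqueFactorizationMonoid R]

/-- **`char(R/(x)) = (x)`** for `x ≠ 0` in a Noetherian UFD: factor `x = u·∏ L` into primes; the
local length of `R/(∏ L)` at a height-one `𝔭` is `#{π ∈ L | π ∈ 𝔭}`
(`lengthAt_quotient_span_singleton_multisetProd`, `lengthAt_quotient_span_singleton`), and the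
product of the `𝔭 ^ #{π ∈ L | π ∈ 𝔭}` is `(∏ L)` (`finprod_heightOne_pow_eq_span_prod`).
[Bourbaki AC VII §4.7; folklore] -/
theorem charIdeal_quotient_span_singleton {x : R} (hx : x ≠ 0) :
    charIdeal R (R ⧸ Ideal.span {x}) = Ideal.span {x} := by
  set L := UniqueFactorizationMonoid.factors x with hL
  have hLp : ∀ π ∈ L, Prime π := fun π hπ => UniqueFactorizationMonoid.prime_of_factor π hπ
  have hassoc : Associated L.prod x := UniqueFactorizationMonoid.factors_prod hx
  have hspan : Ideal.span {x} = Ideal.span {L.prod} :=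
    Ideal.span_singleton_eq_span_singleton.mpr hassoc.symm
  have e : (R ⧸ Ideal.span {x}) ≃ₗ[R] R ⧸ Ideal.span {L.prod} := Submodule.quotEquivOfEq _ _ hspan
  rw [charIdeal_eq_of_linearEquiv e, hspan]
  refine Eq.trans ?_ (finprod_heightOne_pow_eq_span_prod L hLp)
  unfold charIdeal
  refine finprod_mem_congr rfl fun 𝔭 h𝔭 => ?_
  congr 1
  rw [lengthAt_quotient_span_singleton_multisetProd L (fun a ha => (hLp a ha).ne_zero) 𝔭]
  have hmap : L.map (fun a => lengthAt R (R ⧸ Ideal.span {a}) 𝔭) =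
      L.map (fun a => ((if a ∈ 𝔭.asIdeal then 1 else 0 : ℕ) : ℕ∞)) := by
    refine Multiset.map_congr rfl fun a ha => ?_
    rw [lengthAt_quotient_span_singleton (hLp a ha) 𝔭 h𝔭]
    split_ifs <;> simp
  rw [hmap]
  show ENat.toNat (Multiset.map ((Nat.cast : ℕ → ℕ∞) ∘ fun π => if π ∈ 𝔭.asIdeal then (1 : ℕ) else 0)
    L).sum = _
  rw [← Multiset.map_map, ← Nat.cast_multiset_sum, ENat.toNat_coe]

/-- `char(R/𝔮) = 𝔮` for a height-one prime `𝔮` of a Noetherian UFD. -/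
theorem charIdeal_quotient_eq_of_height_eq_one (𝔮 : PrimeSpectrum R) (h1 : 𝔮.asIdeal.height = 1) :
    charIdeal R (R ⧸ 𝔮.asIdeal) = 𝔮.asIdeal := by
  obtain ⟨g, hg⟩ := UniqueFactorizationMonoid.isPrincipal_of_height_eq_one h1
  have hq : 𝔮.asIdeal = Ideal.span {g} := by rw [hg, Ideal.submodule_span_eq]
  have hg0 : g ≠ 0 := by
    rintro rfl
    exact Ideal.ne_bot_of_height_eq_one h1 (by rw [hq, Ideal.span_singleton_eq_bot])
  have e : (R ⧸ 𝔮.asIdeal) ≃ₗ[R] R ⧸ Ideal.span {g} := Submodule.quotEquivOfEq _ _ hq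
  rw [charIdeal_eq_of_linearEquiv e, charIdeal_quotient_span_singleton hg0, ← hq]

end Generic

/-! ## §2 Base change along a flat extension -/

section BaseChange

variable {A : Type u} [CommRing A] {B : Type v} [CommRing B] [Algebra A B]

/-- A module that is a quotient `A/𝔮` and is killed by `q` has `q ∈ 𝔮`. -/
theorem mem_of_equiv_quotient {N : Type w} [AddCommGroup N] [Module A N] {𝔮 : Ideal A}
    (e : N ≃ₗ[A] A ⧸ 𝔮) {q : A} (hq : ∀ x : N, q • x = 0) : q ∈ 𝔮 := by
  have h := congrArg e (hq (e.symm (Ideal.Quotient.mk 𝔮 1)))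
  rw [map_smul, LinearEquiv.apply_symm_apply, map_zero,
    ← IsScalarTower.algebraMap_smul (A ⧸ 𝔮) q, smul_eq_mul, Ideal.Quotient.algebraMap_eq, ← map_mul,
    mul_one, Ideal.Quotient.eq_zero_iff_mem] at h
  exact h

/-- If `c` kills `N` then `algebraMap A B c` kills `B ⊗[A] N`. -/
theorem smul_baseChange_eq_zero {N : Type w} [AddCommGroup N] [Module A N] {c : A}
    (hcN : ∀ x : N, c • x = 0) (y : B ⊗[A] N) : algebraMap A B c • y = 0 := by
  induction y using TensorProduct.induction_on with
  | zero => rw [smul_zero]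
  | tmul b n =>
    rw [TensorProduct.smul_tmul', smul_eq_mul, ← Algebra.smul_def, TensorProduct.smul_tmul, hcN n,
      TensorProduct.tmul_zero]
  | add x y hx hy => rw [smul_add, hx, hy, add_zero]

/-- Going-down for a flat extension: a prime of `B` has height at least that of its contraction
(Mathlib: flat ⇒ `HasGoingDown`; `Ideal.height_eq_height_add_of_liesOver_of_hasGoingDown`). -/
theorem height_under_le [IsNoetherianRing A] [IsNoetherianRing B] [Module.Flat A B]
    (𝔓' : PrimeSpectrum B) :
    (𝔓'.asIdeal.under A).height ≤ 𝔓'.asIdeal.height := by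
  rw [Ideal.height_eq_height_add_of_liesOver_of_hasGoingDown (𝔓'.asIdeal.under A) 𝔓'.asIdeal]
  exact le_self_add

variable [IsNoetherianRing A] [IsDomain A] [UniqueFactorizationMonoid A]
  [IsNoetherianRing B] [IsDomain B] [UniqueFactorizationMonoid B] [Module.Flat A B]

/-- **(G0-bc): the characteristic ideal commutes with flat base change of Noetherian UFDs.** For
`A → B` injective and flat and a finitely generated `A`-module `N` killed by some `c ≠ 0`:
`char_B(B ⊗_A N) = char_A(N)·B`.
Noetherian induction on `N`: multiplicativity of `char` in exact sequences on both sides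
(`Module.charIdeal_eq_mul_of_exact`; flatness keeps `B ⊗ –` exact); for `N = A/𝔮` with
`ht 𝔮 = 1`, `𝔮 = (π)`, `B ⊗ N = B/(π)B` and both sides are `(π)B`
(`charIdeal_quotient_span_singleton`); for `ht 𝔮 ≥ 2` both sides are `B` (going-down: a
height-one prime of `B` containing `𝔮B` would contract to a prime of height `≤ 1` containing `𝔮`).
[Bourbaki AC VII §4.5 Prop. 10, §4.7; folklore] -/
theorem charIdeal_baseChange_eq (hf : Function.Injective (algebraMap A B))
    (N : Type w) [AddCommGroup N] [Module A N] [hN : Module.Finite A N]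
    {c : A} (hc : c ≠ 0) (hcN : ∀ x : N, c • x = 0) :
    charIdeal B (B ⊗[A] N) = (charIdeal A N).map (algebraMap A B) := by
  revert hcN
  induction hN using IsNoetherianRing.induction_on_isQuotientEquivQuotientPrime A with
  | subsingleton N =>
    intro _
    haveI : Subsingleton (B ⊗[A] N) := ⟨fun a b => by
      have h1 : ∀ y : B ⊗[A] N, y = 0 := fun y => by
        have := smul_baseChange_eq_zero (B := B) (c := (1 : A))
          (fun x : N => Subsingleton.elim _ _) y
        rwa [map_one, one_smul] at this
      rw [h1 a, h1 b]⟩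
    rw [charIdeal_eq_top_of_subsingleton (R := A) (M := N), Ideal.map_top,
      charIdeal_eq_top_of_subsingleton]
  | quotient N 𝔮 e =>
    intro hcN
    have hc𝔮 : c ∈ 𝔮.asIdeal := mem_of_equiv_quotient e hcN
    have h0 : 𝔮.asIdeal ≠ ⊥ := by
      intro h
      rw [h, Ideal.mem_bot] at hc𝔮
      exact hc hc𝔮
    -- the `B`-linear identification `B ⊗[A] N ≃ B ⧸ 𝔮B`
    have e₁ : (B ⊗[A] N) ≃ₗ[B] B ⧸ 𝔮.asIdeal.map (algebraMap A B) :=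
      (LinearEquiv.baseChange A B _ _ e).trans
        (Algebra.TensorProduct.quotIdealMapEquivTensorQuot B 𝔮.asIdeal).toLinearEquiv.symm
    by_cases h1 : 𝔮.asIdeal.height = 1
    · -- `𝔮 = (g)`, both sides `= (g)B`
      obtain ⟨g, hg⟩ := UniqueFactorizationMonoid.isPrincipal_of_height_eq_one h1
      have hq : 𝔮.asIdeal = Ideal.span {g} := by rw [hg, Ideal.submodule_span_eq]
      have hg0 : g ≠ 0 := by
        rintro rfl
        exact h0 (by rw [hq, Ideal.span_singleton_eq_bot])
      have hfg0 : algebraMap A B g ≠ 0 := fun h => hg0 (hf (by rw [h, map_zero]))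
      have hmapq : 𝔮.asIdeal.map (algebraMap A B) = Ideal.span {algebraMap A B g} := by
        rw [hq, Ideal.map_span, Set.image_singleton]
      have e₂ : (B ⊗[A] N) ≃ₗ[B] B ⧸ Ideal.span {algebraMap A B g} :=
        e₁.trans (Submodule.quotEquivOfEq _ _ hmapq)
      rw [charIdeal_eq_of_linearEquiv e₂, charIdeal_quotient_span_singleton hfg0,
        charIdeal_eq_of_linearEquiv e, charIdeal_quotient_eq_of_height_eq_one 𝔮 h1, hmapq]
    · -- `ht 𝔮 ≥ 2`: both sides are `⊤`
      rw [charIdeal_eq_of_linearEquiv e, charIdeal_quotient_eq_top_of_height_ne_one 𝔮 h0 h1,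
        Ideal.map_top, charIdeal_eq_of_linearEquiv e₁]
      refine charIdeal_eq_top_of_forall fun 𝔓' h𝔓' =>
        lengthAt_quotient_eq_zero_of_not_le fun hle => h1 (le_antisymm ?_ ?_)
      · calc 𝔮.asIdeal.height ≤ (𝔓'.asIdeal.under A).height :=
              Ideal.height_mono (Ideal.map_le_iff_le_comap.mp hle)
          _ ≤ 𝔓'.asIdeal.height := height_under_le 𝔓'
          _ = 1 := h𝔓'
      · rw [Order.one_le_iff_ne_zero, Ne, Ideal.height_eq_zero_iff_eq_bot]
        exact h0
  | exact N₁ N₂ N₃ f g hf₁ hg₃ hfg ih₁ ih₃ =>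
    intro hcN₂
    have hcN₁ : ∀ x : N₁, c • x = 0 := fun x => hf₁ (by rw [map_smul, hcN₂, map_zero])
    have hcN₃ : ∀ x : N₃, c • x = 0 := fun x => by
      obtain ⟨y, rfl⟩ := hg₃ x
      rw [← map_smul, hcN₂, map_zero]
    -- torsion on both sides
    have hT : Module.IsTorsion A N₂ := fun x => ⟨⟨c, mem_nonZeroDivisors_of_ne_zero hc⟩, hcN₂ x⟩
    have hfc0 : algebraMap A B c ≠ 0 := fun h => hc (hf (by rw [h, map_zero]))
    have hT' : Module.IsTorsion B (B ⊗[A] N₂) := fun y =>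
      ⟨⟨algebraMap A B c, mem_nonZeroDivisors_of_ne_zero hfc0⟩, smul_baseChange_eq_zero hcN₂ y⟩
    -- exactness of the base-changed sequence (flatness)
    have hf' : Function.Injective (f.baseChange B) := by
      rw [LinearMap.baseChange_eq_ltensor]
      exact Module.Flat.lTensor_preserves_injective_linearMap f hf₁
    have hg' : Function.Surjective (g.baseChange B) := by
      rw [LinearMap.baseChange_eq_ltensor]
      exact LinearMap.lTensor_surjective _ hg₃
    have hfg' : Function.Exact (f.baseChange B) (g.baseChange B) := by
      rw [LinearMap.baseChange_eq_ltensor, LinearMap.baseChange_eq_ltensor]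
      exact lTensor_exact _ hfg hg₃
    rw [charIdeal_eq_mul_of_exact hT f g hf₁ hg₃ hfg, Ideal.map_mul,
      charIdeal_eq_mul_of_exact hT' _ _ hf' hg' hfg', ih₁ hcN₁, ih₃ hcN₃]

/-- **(G0-bc), the inclusion F1 consumes**: `char_B(B ⊗_A N) ⊆ char_A(N)·B` (from the equality). -/
theorem charIdeal_baseChange_le (hf : Function.Injective (algebraMap A B))
    (N : Type w) [AddCommGroup N] [Module A N] [Module.Finite A N]
    {c : A} (hc : c ≠ 0) (hcN : ∀ x : N, c • x = 0) :
    charIdeal B (B ⊗[A] N) ≤ (charIdeal A N).map (algebraMap A B) :=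
  (charIdeal_baseChange_eq hf N hc hcN).le

/-- **The door-5 form.** If the engine gives `(p^a · G) ⊆ char_B(B ⊗_A X)` over the big
coefficient ring and `char` commutes with the (flat) base change, then
`(p^a · G) ⊆ char_A(X)·B` — the shape of F1 / of the crux after `Ideal.map`. -/
theorem span_le_map_charIdeal_of_engine (hf : Function.Injective (algebraMap A B))
    (X : Type w) [AddCommGroup X] [Module A X] [Module.Finite A X]
    {c : A} (hc : c ≠ 0) (hcX : ∀ x : X, c • x = 0) {G : B} {a : ℕ} {p : ℕ}
    (hE : Ideal.span {(p : B) ^ a * G} ≤ charIdeal B (B ⊗[A] X)) :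
    Ideal.span {(p : B) ^ a * G} ≤ (charIdeal A X).map (algebraMap A B) :=
  hE.trans (charIdeal_baseChange_le hf X hc hcX)

/-- **F1 shape, end to end (pure algebra).** Coefficient tower `A → B → C` (`Λ₂ → Λ′ = W(𝔽̄_p)⟦T₁⟧⟦T₂⟧ →
𝒪_{ℂ_p}⟦T₁⟧⟦T₂⟧` in the application), `A → B` injective and flat, `X` a finitely generated `A`-module
killed by some `c ≠ 0`, `G₀ ∈ B` a model of `G = φ G₀ ∈ C`. If the engine gives
`(p^a G₀) ⊆ ch_B(B ⊗_A X)` then `(p^a G) ⊆ ch_A(X)·C` along the composite `φ ∘ (A → B)` — literally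
the F1 / crux shape `span {p^a G} ≤ (charIdeal Λ₂ X).map (toUnr₂ …)` once `toUnr₂` is factored
through `B` ((bc-4), frame typing). Nothing arithmetic is used or proved. -/
theorem f1_shape_of_engine (hf : Function.Injective (algebraMap A B))
    {C : Type*} [CommRing C] (φ : B →+* C)
    (X : Type w) [AddCommGroup X] [Module A X] [Module.Finite A X]
    {c : A} (hc : c ≠ 0) (hcX : ∀ x : X, c • x = 0) {G₀ : B} {G : C} (hG : G = φ G₀) {a p : ℕ}
    (hE : Ideal.span {(p : B) ^ a * G₀} ≤ charIdeal B (B ⊗[A] X)) :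
    Ideal.span {(p : C) ^ a * G} ≤ (charIdeal A X).map (φ.comp (algebraMap A B)) := by
  have h1 := Ideal.map_mono (f := φ) (span_le_map_charIdeal_of_engine hf X hc hcX hE)
  rw [Ideal.map_span, Set.image_singleton, map_mul, map_pow, map_natCast, Ideal.map_map] at h1
  rwa [hG]

/-! ## 3. (v1.1) The local length at an UNRAMIFIED height-one prime under flat base change

For door 5's optimal exponent (`QtameDoor5O.door5_explicit`: `a = ℓ_{(p)}(X′)`): along `Λ₂ → Λ′ = Λ_{2,Ŵ′}` the prime `p`
stays prime (`Λ′/p = 𝔽̄_p⟦T₁⟧⟦T₂⟧`), so `ℓ_{(p)Λ′}(Λ′ ⊗ X) = ℓ_{(p)}(X)` = the `μ`-multiplicity of `X` at `(p)`; hence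
`μ_{(p)}(X_Gr₂) = 0 ⟹ μ_{(p)}(X′) = 0 ⟹` door 5 gives `(G) ⊆ ch(X′) = ch(X)·Λ′` with NO `p`-power (crux 20728 as typed). -/

omit [UniqueFactorizationMonoid A] [IsDomain B] [UniqueFactorizationMonoid B] in
/-- The contraction of `(π')` is `(π)` when `π` is prime in `A` and its image `π'` is prime in `B` (`A → B` flat,
Noetherian domains): going-down + Krull's principal ideal theorem give `ht ((π') ∩ A) ≤ 1`, and a height-one prime
containing the prime `π` is `(π)`. -/
theorem under_span_algebraMap_eq {π : A} (hπ : Prime π) (hπ' : Prime (algebraMap A B π)) :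
    (Ideal.span {algebraMap A B π}).under A = Ideal.span {π} := by
  set P' : PrimeSpectrum B :=
    ⟨Ideal.span {algebraMap A B π}, (Ideal.span_singleton_prime hπ'.ne_zero).mpr hπ'⟩ with hP'
  have hmem : π ∈ P'.asIdeal.under A := by
    rw [Ideal.mem_comap]
    exact Ideal.subset_span rfl
  haveI : P'.asIdeal.IsPrime := P'.isPrime
  haveI : P'.asIdeal.IsPrincipal := ⟨algebraMap A B π, rfl⟩
  have hle1 : (P'.asIdeal.under A).height ≤ 1 :=
    (height_under_le P').trans (Ideal.height_le_one_of_isPrincipal_of_mem_minimalPrimes P'.asIdeal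
      P'.asIdeal (by rw [Ideal.minimalPrimes_eq_subsingleton_self]; exact Set.mem_singleton _))
  have hne : P'.asIdeal.under A ≠ ⊥ := fun h => hπ.ne_zero (by
    rw [h, Ideal.mem_bot] at hmem; exact hmem)
  have hht : (P'.asIdeal.under A).height = 1 := by
    refine le_antisymm hle1 ?_
    rw [Order.one_le_iff_ne_zero, Ne, Ideal.height_eq_zero_iff_eq_bot]
    exact hne
  exact Ideal.eq_span_singleton_of_height_eq_one hht hmem hπ

omit [UniqueFactorizationMonoid A] [IsDomain B] [UniqueFactorizationMonoid B] in
/-- **`ℓ_{(π')}(B ⊗_A N) = ℓ_{(π)}(N)`** for `A → B` flat (Noetherian domains; neither injectivity nor factoriality is needed here), `π` prime in `A` with prime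
image `π'` in `B`, and `N` finitely generated killed by some `c ≠ 0`. Noetherian induction as in
`charIdeal_baseChange_eq`: additivity of local lengths in exact sequences (`lengthAt_eq_add_of_exact`, flatness);
`N = A/𝔮`: `𝔮 = (π)` gives `1 = 1` (`lengthAt_quotient_self`), every other `𝔮 ∋ c` gives `0 = 0`
(`lengthAt_quotient_eq_zero_of_not_le`; on the `B`-side `𝔮B ⊆ (π')` would force `𝔮 ⊆ (π') ∩ A = (π)`,
`under_span_algebraMap_eq`). [Bourbaki AC VII §4.4; folklore] -/
theorem lengthAt_baseChange_eq_of_prime {π : A} (hπ : Prime π) (hπ' : Prime (algebraMap A B π))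
    (N : Type w) [AddCommGroup N] [Module A N] [hN : Module.Finite A N]
    {c : A} (hc : c ≠ 0) (hcN : ∀ x : N, c • x = 0) :
    lengthAt B (B ⊗[A] N) ⟨Ideal.span {algebraMap A B π}, (Ideal.span_singleton_prime hπ'.ne_zero).mpr hπ'⟩ =
      lengthAt A N ⟨Ideal.span {π}, (Ideal.span_singleton_prime hπ.ne_zero).mpr hπ⟩ := by
  set P : PrimeSpectrum A := ⟨Ideal.span {π}, (Ideal.span_singleton_prime hπ.ne_zero).mpr hπ⟩ with hP
  set P' : PrimeSpectrum B :=
    ⟨Ideal.span {algebraMap A B π}, (Ideal.span_singleton_prime hπ'.ne_zero).mpr hπ'⟩ with hP'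
  have hunder : P'.asIdeal.under A = P.asIdeal := under_span_algebraMap_eq hπ hπ'
  -- `𝔮B ⊆ (π')` forces `𝔮 ⊆ (π)`
  have key : ∀ 𝔮 : Ideal A, 𝔮.map (algebraMap A B) ≤ P'.asIdeal → 𝔮 ≤ P.asIdeal := fun 𝔮 hle => by
    rw [← hunder]
    exact Ideal.map_le_iff_le_comap.mp hle
  revert hcN
  induction hN using IsNoetherianRing.induction_on_isQuotientEquivQuotientPrime A with
  | subsingleton N =>
    intro _
    haveI : Subsingleton (B ⊗[A] N) := ⟨fun a b => by
      have h1 : ∀ y : B ⊗[A] N, y = 0 := fun y => by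
        have := smul_baseChange_eq_zero (B := B) (c := (1 : A))
          (fun x : N => Subsingleton.elim _ _) y
        rwa [map_one, one_smul] at this
      rw [h1 a, h1 b]⟩
    rw [lengthAt_eq_zero_of_subsingleton, lengthAt_eq_zero_of_subsingleton]
  | quotient N 𝔮 e =>
    intro hcN
    have hc𝔮 : c ∈ 𝔮.asIdeal := mem_of_equiv_quotient e hcN
    have h0 : 𝔮.asIdeal ≠ ⊥ := by
      intro h
      rw [h, Ideal.mem_bot] at hc𝔮
      exact hc hc𝔮
    have e₁ : (B ⊗[A] N) ≃ₗ[B] B ⧸ 𝔮.asIdeal.map (algebraMap A B) :=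
      (LinearEquiv.baseChange A B _ _ e).trans
        (Algebra.TensorProduct.quotIdealMapEquivTensorQuot B 𝔮.asIdeal).toLinearEquiv.symm
    rw [lengthAt_eq_of_linearEquiv e₁, lengthAt_eq_of_linearEquiv e]
    by_cases hq : 𝔮.asIdeal ≤ P.asIdeal
    · -- then `𝔮 = (π)` (a nonzero prime inside a height-one prime)
      have hqeq : 𝔮.asIdeal = P.asIdeal := by
        refine Ideal.eq_of_le_of_height_le (I := 𝔮.asIdeal) (J := P.asIdeal) hq ?_
        haveI : P.asIdeal.IsPrime := P.isPrime
        haveI : P.asIdeal.IsPrincipal := ⟨π, rfl⟩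
        have hP1 : P.asIdeal.height ≤ 1 :=
          Ideal.height_le_one_of_isPrincipal_of_mem_minimalPrimes P.asIdeal P.asIdeal
            (by rw [Ideal.minimalPrimes_eq_subsingleton_self]; exact Set.mem_singleton _)
        refine hP1.trans ?_
        rw [Order.one_le_iff_ne_zero, Ne, Ideal.height_eq_zero_iff_eq_bot]
        exact h0
      have hq𝔮 : 𝔮 = P := PrimeSpectrum.ext hqeq
      subst hq𝔮
      have hmapq : (P.asIdeal).map (algebraMap A B) = P'.asIdeal := by
        show (Ideal.span {π}).map (algebraMap A B) = Ideal.span {algebraMap A B π}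
        rw [Ideal.map_span, Set.image_singleton]
      rw [lengthAt_eq_of_linearEquiv (Submodule.quotEquivOfEq _ _ hmapq), lengthAt_quotient_self,
        lengthAt_quotient_self]
    · -- both sides vanish
      rw [lengthAt_quotient_eq_zero_of_not_le hq,
        lengthAt_quotient_eq_zero_of_not_le fun hle => hq (key _ hle)]
  | exact N₁ N₂ N₃ f g hf₁ hg₃ hfg ih₁ ih₃ =>
    intro hcN₂
    have hcN₁ : ∀ x : N₁, c • x = 0 := fun x => hf₁ (by rw [map_smul, hcN₂, map_zero])
    have hcN₃ : ∀ x : N₃, c • x = 0 := fun x => by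
      obtain ⟨y, rfl⟩ := hg₃ x
      rw [← map_smul, hcN₂, map_zero]
    have hf' : Function.Injective (f.baseChange B) := by
      rw [LinearMap.baseChange_eq_ltensor]
      exact Module.Flat.lTensor_preserves_injective_linearMap f hf₁
    have hg' : Function.Surjective (g.baseChange B) := by
      rw [LinearMap.baseChange_eq_ltensor]
      exact LinearMap.lTensor_surjective _ hg₃
    have hfg' : Function.Exact (f.baseChange B) (g.baseChange B) := by
      rw [LinearMap.baseChange_eq_ltensor, LinearMap.baseChange_eq_ltensor]
      exact lTensor_exact _ hfg hg₃
    rw [lengthAt_eq_add_of_exact f g hf₁ hg₃ hfg, lengthAt_eq_add_of_exact _ _ hf' hg' hfg',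
      ih₁ hcN₁, ih₃ hcN₃]

omit [UniqueFactorizationMonoid A] [IsDomain B] [UniqueFactorizationMonoid B] in
/-- **The `μ = 0` transfer**: `ℓ_{(π)}(N) = 0 ⟹ ℓ_{(π')}(B ⊗_A N) = 0` (the instance door 5 consumes:
`μ_{(p)}(X_Gr₂) = 0 ⟹ μ_{(p)}(Λ′ ⊗ X_Gr₂) = 0`, then `QtameDoor5O.door5_mu_zero`). -/
theorem lengthAt_baseChange_eq_zero_of_prime {π : A} (hπ : Prime π) (hπ' : Prime (algebraMap A B π))
    (N : Type w) [AddCommGroup N] [Module A N] [Module.Finite A N]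
    {c : A} (hc : c ≠ 0) (hcN : ∀ x : N, c • x = 0)
    (hμ : lengthAt A N ⟨Ideal.span {π}, (Ideal.span_singleton_prime hπ.ne_zero).mpr hπ⟩ = 0) :
    lengthAt B (B ⊗[A] N) ⟨Ideal.span {algebraMap A B π}, (Ideal.span_singleton_prime hπ'.ne_zero).mpr hπ'⟩ = 0 := by
  rw [lengthAt_baseChange_eq_of_prime hπ hπ' N hc hcN, hμ]

end BaseChange


/-! ## §4 (v1.2) — `μ`-vanishing descends from ONE line through `(p)` (nilpotent Nakayama)

The passage door 5 ⟹ 20728 AS TYPED: `QtameDoor5O.door5_mu_zero` wants `ℓ_{(p)}(X′) = 0`, which is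
`ℓ_{(p)}(X_Gr₂)` by §3; and `ℓ_P(N) = 0` follows from `ℓ_Q(N ⧸ xN) = 0` for ANY element `x` and ANY
prime `Q ⊇ P` containing `x` — here `x = T₁` (the cyclotomic variable), `P = (p)`, `Q = (p, T₁)`, and
`X_Gr₂ ⧸ T₁ X_Gr₂ ≅ X_ac` (exact control, `Lines/ratlift.lean` v4 `controlExactSS`), so that
`ℓ_{(p,T₁)}(X_Gr₂/T₁) = ℓ^{Λ₁}_{(p)}(X_ac) = 0` is ratlift v4's {MU0 `stub_xAcMuZeroSS`, TS1
`stub_xAcTorsionSS`} (`μ(X_ac) = 0`, torsion). Nothing new is owed for the as-typed form beyond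
ratlift v4's registered inputs; this section only isolates the commutative algebra of that step
(the tree's nilpotent Nakayama lemma `CyclicDescent.lengthAt_eq_zero_iff_lengthAt_quotient_range_eq_zero`
plus generisation `P ≤ Q`). -/

section Specialisation

open scoped Pointwise

variable {A : Type u} [CommRing A] (N : Type w) [AddCommGroup N] [Module A N]

/-- `ℓ_Q(N) = 0 ⟹ ℓ_P(N) = 0` for `P ⊆ Q` (`N_P` is a localisation of `N_Q`). [folklore] -/
theorem lengthAt_eq_zero_of_le {P Q : PrimeSpectrum A} (hPQ : P.asIdeal ≤ Q.asIdeal)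
    (h : lengthAt A N Q = 0) : lengthAt A N P = 0 := by
  rw [lengthAt_eq_zero_iff, LocalizedModule.subsingleton_iff] at h ⊢
  intro m
  obtain ⟨s, hs, hsm⟩ := h m
  exact ⟨s, fun hsP => hs (hPQ hsP), hsm⟩

/-- `range (x • ·) = x • N`. -/
theorem range_toLinearMap_eq_smul_top (x : A) :
    LinearMap.range (DistribSMul.toLinearMap A N x) = x • (⊤ : Submodule A N) := by
  ext m
  simp only [LinearMap.mem_range, DistribSMul.toLinearMap_apply,
    Submodule.mem_smul_pointwise_iff_exists, Submodule.mem_top, true_and]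

/-- **`ℓ_Q(N ⧸ xN) = 0`, `x ∈ Q`, `P ⊆ Q` ⟹ `ℓ_P(N) = 0`** (`N` finitely generated): nilpotent Nakayama
at `Q` (tree `CyclicDescent.lengthAt_eq_zero_iff_lengthAt_quotient_range_eq_zero` with `ν = x•`, `k = 1`)
and generisation. Use: `A = Λ₂` (or `Λ′`), `x = T₁`, `P = (p)`, `Q = (p, T₁)`.
[cite: Matsumura1987, Thm. 2.2 (Nakayama)] -/
theorem lengthAt_eq_zero_of_lengthAt_quotient_smul_top_eq_zero [Module.Finite A N] {x : A}
    {P Q : PrimeSpectrum A} (hx : x ∈ Q.asIdeal) (hPQ : P.asIdeal ≤ Q.asIdeal)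
    (h : lengthAt A (N ⧸ x • (⊤ : Submodule A N)) Q = 0) : lengthAt A N P = 0 := by
  refine lengthAt_eq_zero_of_le N hPQ ?_
  have hν : LinearMap.range (DistribSMul.toLinearMap A N x ^ 1) ≤ x • (⊤ : Submodule A N) := by
    rw [pow_one, range_toLinearMap_eq_smul_top]
  rw [Summit.BirchSwinnertonDyer.BirchSwinnertonDyer.Theorems.AlignedTransportAtTwoFineRoad.CyclicDescent.lengthAt_eq_zero_iff_lengthAt_quotient_range_eq_zero
    Q hx _ hν]
  have e : (N ⧸ LinearMap.range (DistribSMul.toLinearMap A N x)) ≃ₗ[A]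
      N ⧸ x • (⊤ : Submodule A N) :=
    Submodule.quotEquivOfEq _ _ (range_toLinearMap_eq_smul_top N x)
  rw [lengthAt_eq_of_linearEquiv e]
  exact h

/-- The two steps together, in the shape the door-5 supply file consumes: along a FLAT `A → B` with
`π ↦ π'` prime (§3) and a line `x ∈ Q ⊇ (π)` of `A` (§4):
`ℓ_Q(N ⧸ xN) = 0 ⟹ ℓ_{(π')}(B ⊗_A N) = 0`. -/
theorem lengthAt_baseChange_eq_zero_of_quotient_line {B : Type v} [CommRing B] [Algebra A B]
    [IsNoetherianRing A] [IsDomain A] [IsNoetherianRing B] [IsDomain B] [Module.Flat A B]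
    {π : A} (hπ : Prime π) (hπ' : Prime (algebraMap A B π))
    [Module.Finite A N] {c : A} (hc : c ≠ 0) (hcN : ∀ n : N, c • n = 0)
    {x : A} {Q : PrimeSpectrum A} (hx : x ∈ Q.asIdeal) (hπQ : Ideal.span {π} ≤ Q.asIdeal)
    (h : lengthAt A (N ⧸ x • (⊤ : Submodule A N)) Q = 0) :
    lengthAt B (B ⊗[A] N) ⟨Ideal.span {algebraMap A B π},
      (Ideal.span_singleton_prime hπ'.ne_zero).mpr hπ'⟩ = 0 :=
  lengthAt_baseChange_eq_zero_of_prime hπ hπ' N hc hcN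
    (lengthAt_eq_zero_of_lengthAt_quotient_smul_top_eq_zero N hx (P := ⟨Ideal.span {π}, _⟩) hπQ h)

end Specialisation


/-! ## §5 (v1.2) — NECESSITY of `μ = 0` for the `p`-power-free form

If `span{G} ≤ ch_A(N)·C` along `φ : A → C` and `μ_{(π)}(N) ≥ 1`, then `φ π ∣ G` (`ch_A(N) ⊆ (π)^{μ} ⊆ (π)`,
tree `CongruenceLimit.charIdeal_le_pow_lengthAt`). For crux 20728: `A = Λ₂`, `π = p`, `C = 𝒪_{ℂ_p}⟦T₁⟧⟦T₂⟧`,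
`φ = toUnr₂ p J`; the crux's own antecedent (BCS 2025 Prop. 4.2.2, `HasUnitContent (minus G)`) excludes
`p ∣ G`, so the as-typed conclusion forces `μ_{(p)}(X_Gr₂) = 0` — the `μ`-input of §4 is not an artefact
of door 5. -/

section Necessity

variable {A : Type u} [CommRing A] [IsNoetherianRing A] [IsDomain A]
  (N : Type w) [AddCommGroup N] [Module A N] [Module.Finite A N]

/-- `(π)` has height one for a prime element `π` of a Noetherian domain. [folklore] -/
theorem height_span_singleton_eq_one {π : A} (hπ : Prime π) : (Ideal.span {π}).height = 1 := by
  haveI : (Ideal.span {π}).IsPrime := (Ideal.span_singleton_prime hπ.ne_zero).mpr hπ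
  haveI : (Ideal.span {π}).IsPrincipal := ⟨π, rfl⟩
  refine le_antisymm (Ideal.height_le_one_of_isPrincipal_of_mem_minimalPrimes (Ideal.span {π})
    (Ideal.span {π}) (by rw [Ideal.minimalPrimes_eq_subsingleton_self]; exact Set.mem_singleton _)) ?_
  rw [Order.one_le_iff_ne_zero, Ne, Ideal.height_eq_zero_iff_eq_bot, Ideal.span_singleton_eq_bot]
  exact hπ.ne_zero

/-- **`span{G} ≤ ch(N)·C` and `μ_{(π)}(N) ≥ 1` ⟹ `φ π ∣ G`.** [folklore] -/
theorem dvd_of_span_le_map_charIdeal {C : Type v} [CommRing C] (φ : A →+* C)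
    (hN : Module.IsTorsion A N) {π : A} (hπ : Prime π)
    (hμ : (lengthAt A N ⟨Ideal.span {π}, (Ideal.span_singleton_prime hπ.ne_zero).mpr hπ⟩).toNat ≠ 0)
    {G : C} (hG : Ideal.span {G} ≤ (charIdeal A N).map φ) : φ π ∣ G := by
  set P : PrimeSpectrum A := ⟨Ideal.span {π}, (Ideal.span_singleton_prime hπ.ne_zero).mpr hπ⟩
  have h1 : charIdeal A N ≤ Ideal.span {π} :=
    (Summit.BirchSwinnertonDyer.Rank1Residual.X11b.CongruenceLimit.charIdeal_le_pow_lengthAt hN P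
      (height_span_singleton_eq_one hπ)).trans (Ideal.pow_le_self hμ)
  have h2 : (charIdeal A N).map φ ≤ Ideal.span {φ π} := by
    refine (Ideal.map_mono h1).trans ?_
    rw [Ideal.map_span, Set.image_singleton]
  exact Ideal.mem_span_singleton.mp (h2 (hG (Ideal.mem_span_singleton_self G)))

/-- Contrapositive, the form the dossier quotes: if `φ π ∤ G` (e.g. `G` has a unit coefficient modulo
`φ π`) then the `p`-power-free inclusion forces `μ_{(π)}(N) = 0` (as a natural number; for torsion `N`
the local length at a height-one prime is finite, so this is `lengthAt = 0`). -/
theorem toNat_lengthAt_eq_zero_of_span_le_map_charIdeal {C : Type v} [CommRing C] (φ : A →+* C)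
    (hN : Module.IsTorsion A N) {π : A} (hπ : Prime π) {G : C} (hndvd : ¬ φ π ∣ G)
    (hG : Ideal.span {G} ≤ (charIdeal A N).map φ) :
    (lengthAt A N ⟨Ideal.span {π}, (Ideal.span_singleton_prime hπ.ne_zero).mpr hπ⟩).toNat = 0 := by
  by_contra hμ
  exact hndvd (dvd_of_span_le_map_charIdeal N φ hN hπ hμ hG)

end Necessity


/-! ## §6 (v1.3) — (bc-5) in the ZERO currency: restriction of scalars, and MU0's unit-content currency

Critic V#26q lists as (bc-5) the change-of-rings step between ratlift's one-variable currency (MU0, TS1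
over `Λ₁ = IwasawaAlgebra p` for `X_ac ≅ X_Gr₂/T₁`) and §4's hypothesis `ℓ^{Λ₂}_{(p,T₁)}(X_Gr₂/T₁) = 0`.
For the ZERO statement no length identity is needed: (i) if `S` acts on `N` through `f : S → A` then
`ℓ^S_{f⁻¹Q}(N) = 0 ⟹ ℓ^A_Q(N) = 0` (a killer outside `f⁻¹Q` maps to a killer outside `Q`); (ii) MU0's
currency `∃ g ∈ ch(N), π ∤ g` gives `ℓ_{(π)}(N) = 0` for torsion `N` (§5 with `φ = id`, plus finiteness of
the local length at a height-one prime, tree `lengthAt_ne_top_of_isTorsionBy`). What stays frame-level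
typing: `f⁻¹(p, T₁) = (p)` for the structure map `f : Λ₁ → Λ₂` of ratlift's `controlExactSS`, and the
`IsScalarTower` compatibility of that `Λ₁`-structure (both hold by construction for `f = PowerSeries.C`);
`HasUnitContent g → ¬ (p : Λ₁) ∣ g` is the tree's `GreenbergVatsal2000.CongruentCurves.hasUnitContent_iff_not_C_dvd`. -/

section Transport

variable {S : Type*} [CommRing S] {A : Type u} [CommRing A]
  (N : Type w) [AddCommGroup N] [Module S N] [Module A N]

/-- **(bc-5)(i)** `ℓ^S_{f⁻¹Q}(N) = 0 ⟹ ℓ^A_Q(N) = 0` when `S` acts on `N` through `f : S →+* A`. [folklore] -/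
theorem lengthAt_eq_zero_of_lengthAt_comap_eq_zero (f : S →+* A) (hf : ∀ (t : S) (n : N), t • n = f t • n)
    (Q : PrimeSpectrum A)
    (h : lengthAt S N ⟨Q.asIdeal.comap f, Ideal.IsPrime.comap f⟩ = 0) : lengthAt A N Q = 0 := by
  rw [lengthAt_eq_zero_iff, LocalizedModule.subsingleton_iff] at h ⊢
  intro m
  obtain ⟨t, ht, htm⟩ := h m
  exact ⟨f t, ht, by rw [← hf]; exact htm⟩

/-- The same with the compatibility packaged as `[Algebra S A] [IsScalarTower S A N]`. -/
theorem lengthAt_eq_zero_of_lengthAt_comap_algebraMap_eq_zero [Algebra S A] [IsScalarTower S A N]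
    (Q : PrimeSpectrum A)
    (h : lengthAt S N ⟨Q.asIdeal.comap (algebraMap S A), Ideal.IsPrime.comap _⟩ = 0) :
    lengthAt A N Q = 0 :=
  lengthAt_eq_zero_of_lengthAt_comap_eq_zero N (algebraMap S A) (fun t n => (algebraMap_smul A t n).symm) Q h

end Transport

section UnitContentCurrency

variable {A : Type u} [CommRing A] [IsNoetherianRing A] [IsDomain A]
  (N : Type w) [AddCommGroup N] [Module A N] [Module.Finite A N]

/-- **(bc-5)(ii)** MU0's currency: `g ∈ ch(N)` with `π ∤ g` (e.g. `g` with a unit coefficient, `π = p`) and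
`N` torsion ⟹ `ℓ_{(π)}(N) = 0`. [folklore] -/
theorem lengthAt_eq_zero_of_mem_charIdeal_of_not_dvd (hN : Module.IsTorsion A N) {π : A} (hπ : Prime π)
    {g : A} (hg : g ∈ charIdeal A N) (hndvd : ¬ π ∣ g) :
    lengthAt A N ⟨Ideal.span {π}, (Ideal.span_singleton_prime hπ.ne_zero).mpr hπ⟩ = 0 := by
  set P : PrimeSpectrum A := ⟨Ideal.span {π}, (Ideal.span_singleton_prime hπ.ne_zero).mpr hπ⟩ with hP
  have hP1 : P.asIdeal.height ≤ 1 := (height_span_singleton_eq_one hπ).le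
  have hndvd' : ¬ (RingHom.id A) π ∣ g := hndvd
  have hle : Ideal.span {g} ≤ (charIdeal A N).map (RingHom.id A) := by
    rw [Ideal.map_id, Ideal.span_singleton_le_iff_mem]; exact hg
  have h0 : (lengthAt A N P).toNat = 0 :=
    toNat_lengthAt_eq_zero_of_span_le_map_charIdeal N (RingHom.id A) hN hπ hndvd' hle
  obtain ⟨s, hs, hs0⟩ := Submodule.annihilator_top_inter_nonZeroDivisors hN
  have hfin : lengthAt A N P ≠ ⊤ :=
    lengthAt_ne_top_of_isTorsionBy (M := N) (nonZeroDivisors.ne_zero hs0)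
      (fun m => Submodule.mem_annihilator.mp hs m Submodule.mem_top) P hP1
  rcases ENat.toNat_eq_zero.mp h0 with h | h
  · exact h
  · exact absurd h hfin

end UnitContentCurrency


/-! ## §7 (v1.4) — (bc-5′) generically: `C⁻¹(C c, X) = (c)` in `R⟦X⟧`

Critic V#26r replaces (bc-5) by two frame identities of ratlift v4's constants structure (`Λ₂ = Λ₁⟦T₁⟧`,
`Module Λ₁ X_Gr₂ := Module.compHom _ PowerSeries.C`): (bc-5′) `((p, T₁) : Ideal Λ₂).comap C = (p)` and
(bc-5″) `t • n = C t • n`. (bc-5″) is `rfl` for `Module.compHom` (so §6(i)'s `hf` is `fun _ _ => rfl` at the use site);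
(bc-5′) is the following lemma with `R = Λ₁`, `c = p` (`map_natCast C p : C (p : Λ₁) = (p : Λ₂)`). What then remains of
(bc-5) is instantiation only. -/

section ComapC

variable {R : Type*} [CommRing R]

/-- **(bc-5′)** `(Ideal.span {C c, X}).comap C = Ideal.span {c}` in `R⟦X⟧` (constant coefficients). [folklore] -/
theorem comap_C_span_C_X_eq (c : R) :
    (Ideal.span {PowerSeries.C c, (PowerSeries.X : PowerSeries R)}).comap (PowerSeries.C (R := R)) =
      Ideal.span {c} := by
  apply le_antisymm
  · intro r hr
    rw [Ideal.mem_comap, Ideal.mem_span_pair] at hr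
    obtain ⟨a, b, hab⟩ := hr
    have h := congrArg (PowerSeries.constantCoeff (R := R)) hab
    rw [map_add, map_mul, map_mul, PowerSeries.constantCoeff_C, PowerSeries.constantCoeff_X, mul_zero, add_zero,
      PowerSeries.constantCoeff_C] at h
    exact Ideal.mem_span_singleton'.mpr ⟨PowerSeries.constantCoeff a, h⟩
  · rw [Ideal.span_le, Set.singleton_subset_iff, SetLike.mem_coe, Ideal.mem_comap]
    exact Ideal.subset_span (Set.mem_insert _ _)

/-- The same with `c = p` a natural number cast: `(Ideal.span {(p : R⟦X⟧), X}).comap C = Ideal.span {(p : R)}`. -/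
theorem comap_C_span_natCast_X_eq (p : ℕ) :
    (Ideal.span {(p : PowerSeries R), (PowerSeries.X : PowerSeries R)}).comap (PowerSeries.C (R := R)) =
      Ideal.span {(p : R)} := by
  rw [← map_natCast (PowerSeries.C (R := R)) p]
  exact comap_C_span_C_X_eq (p : R)

/-- (bc-5″) for the record: under `Module.compHom N f` the two actions agree definitionally. -/
theorem compHom_smul_eq {S : Type*} [CommRing S] {A : Type u} [CommRing A] (f : S →+* A)
    (N : Type w) [AddCommGroup N] [Module A N] (t : S) (n : N) :
    (letI : Module S N := Module.compHom N f; t • n) = f t • n := rfl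

end ComapC

end Summit.BirchSwinnertonDyer.BirchSwinnertonDyer.Cruxes.TwoVariableEulerSystemDivisibility.QtameBaseChange

end
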